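import Mathlib
import Summits.Ventures.HodgeRepro2.Tier7.Line1.TwoTorus

/-!
# Tier 7 — LINE 1: local sign data and THE PARITY CONSTRAINT (`Line1/SignData.lean`; t7-L1-p3)

Prover product for LINE 1 (t7-plan-1's HECKE-MODULE RIGIDITY line), lemma p3 of LEMMAS.md §3 / Skeleton v6 §8:
the structure `SignData D T R` (the local Tunnell–Saito sign data of a transport `R : TransportData D T`, REGISTERED in
the skeleton — fields byte-identical) and the kernel theorem `parity_of_swapOK` (registered signature): a
sign-compatible constituent `σ` is endoscopic (two-member local packet) at an EVEN number of places of the swap set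
`S` iff the two global constants `cA`, `cB` of the product formulas agree. With it the skeleton's obstruction
`not_two_torus_of_parity` (t7-plan-1's proof, reproduced verbatim), four corollaries: `even_of_swapOK`,
`not_swapOK_of_even_of_ne`, `even_filter_of_forall_two` (the only consumer of `S_even`), `cA_eq_cB_of_forall_two`, and
the sanity instance `tautSignData` / `signData_nonempty` (the interface is inhabited over every transport, so it
carries no axiom by itself — as `tautTwoTorusData` for `TwoTorusData`).

WHAT IS PROVED AND WHAT IS NOT. Everything below is finite combinatorics in `ℤˣ` over the displayed structure: no
field of the frozen target is consumed, no non-vanishing is asserted, and the statement (P) is not touched — the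
theorem is the ±1 bookkeeping behind LEMMAS.md §2(e): GIVEN the printed inputs displayed as the Prop fields of
`SignData` (Tunnell 1983 / Saito 1993 / GGP 2012 Thm 10.1 + Prasad 1994 for the local rule and the singleton clause;
the product formula for the local signs with both global root numbers `+1`; Artin reciprocity for `S_even`) it is a
NECESSARY parity condition on a sign-compatible constituent; whether it cuts anything on the real objects (where the
two-member part of the swap set is expected to be all of `S`, so the condition reduces to `cA = cB`) is a question for
the line's census, not a claim of this file (HOME proofs/t7/L1/PARITY-p3.md §3). Paper proof: PARITY-p3.md §1. Imports: `Mathlib` + `Summits.Ventures.HodgeRepro2.Tier7.Line1.TwoTorus`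
(→ `Line1.Defs` → `Tier7.Target`). Sorry-free; axioms of every theorem: propext / Classical.choice / Quot.sound.
§8(d): uses an L-value-free non-vanishing device: NO (sign bookkeeping; proves no non-vanishing).
-/

namespace Summit.Ventures.HodgeRepro2.Tier7.Line1

open Summit.Ventures.HodgeRepro2.Tier7

section

variable {K : Type} [Field K] [NumberField K] {E' : Type} [Field E'] [NumberField E']
  {V : Type} [AddCommGroup V] [Module E' V] {HX : Type} [Ring HX] [Algebra ℂ HX]
  {G : Type} [Group G] [MulAction G HX] (D : PeriodDatum K E' V HX G)

/-! ## 8. Local sign data and THE PARITY CONSTRAINT (t7-L1-p3; Skeleton v6 §8, LEMMAS.md §2(e), §3 p3)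

The swap set `S = {v : η_v(u) = −1} = S_g ∪ {ι_2}` is EVEN (Artin reciprocity for the cyclic `E′/E′⁺`; TIER5 N0.3:
`|S_g|` odd). At a place `v` where the local `L`-packet of `σ_v` has TWO members, Tunnell–Saito (Tunnell 1983 / Saito
1993; unitary form GGP 2012 Thm 10.1, dihedral refinement Prasad 1994) says WHICH member carries the
`(T_v, χ_v)`-functional; the sign `ε_v(σ, χ) ∈ {±1}` records it (`+1` = the base-point member `σ_v`). `swapOK σ`
(TwoTorus.lean §7) says: the members carrying `χ_{A,v}` and `χ_{B',v}` agree off `S` and are swapped on `S`. With the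
product formulas `∏_v ε_v(σ, χ) = c(χ)` (global root numbers `+1`) one gets THE PARITY THEOREM (`parity_of_swapOK`,
kernel): for a sign-compatible `σ`, `#{v ∈ S : the packet of σ_v has two members}` is EVEN iff `c(χ_A) = c(χ_B')`.
The structure `SignData` is the one REGISTERED in the skeleton (§8, byte-identical fields); its Prop fields are printed
facts about the real objects (locators in proofs/t7/INPUTS.md); nothing here is the step. Paper proof:
proofs/t7/L1/PARITY-p3.md. -/

/-- (t7-L1-p3) the LOCAL SIGN DATA of a transport (all fields printed facts about the real objects, INPUTS.md):
`Place` = a set of places of `F` containing the swap set `S` (`S_even`: Artin reciprocity, `|S_g|` odd + `ι_2`);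
`two σ v` = «the local `L`-packet of `σ_v` has two members»; `epsA σ v`, `epsB σ v` = the Tunnell–Saito signs of
`(σ_v, χ_{A,v})`, `(σ_v, χ_{B',v})` (`+1` = the functional lives on the base-point member); `eps_eq_of_not_two` =
on a singleton packet both functionals exist; `local_rule` = `swapOK` unfolded (LEMMAS.md §2(e)); `prod_A`, `prod_B`
= the product formulas `∏_v ε_v(σ, χ) = ε(1/2, BC(σ) × χ) · c(χ)` with the global root numbers `+1` (necessary for
the central values to be non-zero), so `cA`, `cB` are the constants `c(χ_A)`, `c(χ_B')`. -/
structure SignData (T : TwoTorusData D) (R : TransportData D T) where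
  Place : Type
  S : Finset Place
  S_even : Even S.card
  two : T.Cons → Place → Bool
  epsA : T.Cons → Place → ℤˣ
  epsB : T.Cons → Place → ℤˣ
  supp : T.Cons → Finset Place
  S_subset : ∀ σ, S ⊆ supp σ
  eps_eq_of_not_two : ∀ σ v, two σ v = false → epsA σ v = epsB σ v
  local_rule : ∀ σ, R.swapOK σ ↔ ∀ v, two σ v = true → (epsA σ v = epsB σ v ↔ v ∉ S)
  cA : ℤˣ
  cB : ℤˣ
  prod_A : ∀ σ, ∏ v ∈ supp σ, epsA σ v = cA
  prod_B : ∀ σ, ∏ v ∈ supp σ, epsB σ v = cB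

namespace SignData

variable {D} {T : TwoTorusData D} {R : TransportData D T} (N : SignData D T R)

/-- (PROVED) the local product of the two signs at a place of a sign-compatible `σ`: `−1` exactly at the two-member
places of the swap set, `+1` elsewhere (`local_rule` + `eps_eq_of_not_two`; in `ℤˣ` two distinct units are
negatives of each other) -/
theorem epsA_mul_epsB_of_swapOK (σ : T.Cons) (h : R.swapOK σ) (v : N.Place)
    [Decidable (v ∈ N.S ∧ N.two σ v = true)] :
    N.epsA σ v * N.epsB σ v = if v ∈ N.S ∧ N.two σ v = true then -1 else 1 := by
  have hloc : ∀ v, N.two σ v = true → (N.epsA σ v = N.epsB σ v ↔ v ∉ N.S) := (N.local_rule σ).mp h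
  split_ifs with hv
  · obtain ⟨hvS, hv2⟩ := hv
    have hne : N.epsA σ v ≠ N.epsB σ v := fun heq => ((hloc v hv2).mp heq) hvS
    rw [Int.units_ne_iff_eq_neg.mp hne, neg_mul, Int.units_mul_self]
  · have heq : N.epsA σ v = N.epsB σ v := by
      cases hv2 : N.two σ v with
      | true => exact (hloc v hv2).mpr (fun hvS => hv ⟨hvS, hv2⟩)
      | false => exact N.eps_eq_of_not_two σ v hv2
    rw [heq, Int.units_mul_self]

/-- (PROVED) the product of the two global constants is `(−1)^{#{v ∈ S : two-member packet}}` for a sign-compatible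
`σ`: the two product formulas multiplied place by place over `supp σ ⊇ S` -/
theorem cA_mul_cB_of_swapOK (σ : T.Cons) (h : R.swapOK σ) :
    N.cA * N.cB = (-1) ^ (N.S.filter (fun v => N.two σ v = true)).card := by
  classical
  rw [← N.prod_A σ, ← N.prod_B σ, ← Finset.prod_mul_distrib]
  rw [Finset.prod_congr rfl (fun v _ => N.epsA_mul_epsB_of_swapOK σ h v)]
  rw [Finset.prod_ite, Finset.prod_const_one, mul_one, Finset.prod_const]
  congr 2
  ext v
  simp only [Finset.mem_filter]
  exact ⟨fun hv => ⟨hv.2.1, hv.2.2⟩, fun hv => ⟨N.S_subset σ hv.1, hv.1, hv.2⟩⟩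

end SignData

/-- (t7-L1-p3; PROVED — pure finite combinatorics over `SignData`) THE PARITY CONSTRAINT (LEMMAS.md §2(e)): a
sign-compatible constituent is endoscopic (two-member packet) at an EVEN number of swap places iff the two global
constants agree. Proof: multiply `prod_A` and `prod_B`; each factor `epsA σ v * epsB σ v` is `1` off `S ∩ two σ` and
`-1` on it (`local_rule`, `eps_eq_of_not_two`), so `cA * cB = (-1) ^ #(S ∩ two σ)`, and `cA * cB = 1 ↔ cA = cB` in
`ℤˣ`. -/
theorem parity_of_swapOK (T : TwoTorusData D) (R : TransportData D T) (N : SignData D T R)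
    (σ : T.Cons) (h : R.swapOK σ) :
    Even (N.S.filter (fun v => N.two σ v = true)).card ↔ N.cA = N.cB := by
  have hprod := N.cA_mul_cB_of_swapOK σ h
  constructor
  · intro heven
    have h1 : N.cA * N.cB = 1 := by rw [hprod]; exact heven.neg_one_pow
    calc N.cA = N.cA * (N.cB * N.cB) := by rw [Int.units_mul_self, mul_one]
      _ = (N.cA * N.cB) * N.cB := by rw [mul_assoc]
      _ = N.cB := by rw [h1, one_mul]
  · intro heq
    have h1 : N.cA * N.cB = 1 := by rw [heq, Int.units_mul_self]
    rw [hprod] at h1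
    exact (neg_one_pow_eq_one_iff_even (by decide)).mp h1

/-- (PROVED; Skeleton v6 §8, t7-plan-1's proof verbatim) the parity constraint as an OBSTRUCTION: if every
constituent's swap-place endoscopy count has the wrong parity, the two-torus statement — hence the crux — is false. -/
theorem not_two_torus_of_parity (T : TwoTorusData D) (R : TransportData D T) (N : SignData D T R)
    (hpar : ∀ σ, Even (N.S.filter (fun v => N.two σ v = true)).card ↔ N.cA ≠ N.cB) : ¬ TwoTorus D T := by
  rintro ⟨σ, hA, hB⟩
  have hsw := R.swapOK_of_periods σ hA hB
  have h1 := parity_of_swapOK D T R N σ hsw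
  have h2 := hpar σ
  by_cases hc : N.cA = N.cB
  · exact (h2.mp (h1.mpr hc)) hc
  · exact hc (h1.mp (h2.mpr hc))

/-- (PROVED) with equal constants, sign compatibility forces an EVEN number of two-member places in the swap set -/
theorem even_of_swapOK (T : TwoTorusData D) (R : TransportData D T) (N : SignData D T R)
    (σ : T.Cons) (h : R.swapOK σ) (hc : N.cA = N.cB) :
    Even (N.S.filter (fun v => N.two σ v = true)).card :=
  (parity_of_swapOK D T R N σ h).mpr hc

/-- (PROVED) the OBSTRUCTION at one constituent: differing constants and an even two-member part of the swap set (in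
particular an EMPTY one) exclude sign compatibility -/
theorem not_swapOK_of_even_of_ne (T : TwoTorusData D) (R : TransportData D T) (N : SignData D T R)
    (σ : T.Cons) (heven : Even (N.S.filter (fun v => N.two σ v = true)).card) (hne : N.cA ≠ N.cB) :
    ¬ R.swapOK σ :=
  fun h => hne ((parity_of_swapOK D T R N σ h).mp heven)

/-- (PROVED, consumes `S_even`) a constituent whose packet has two members at EVERY place of the swap set has an even
two-member part — `|S|` itself is even (Artin reciprocity) -/
theorem even_filter_of_forall_two (T : TwoTorusData D) (R : TransportData D T) (N : SignData D T R)
    (σ : T.Cons) (h2 : ∀ v ∈ N.S, N.two σ v = true) :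
    Even (N.S.filter (fun v => N.two σ v = true)).card := by
  rw [Finset.filter_true_of_mem h2]
  exact N.S_even

/-- (PROVED) for a constituent with two-member packets on all of `S` (the CM-type candidates of the line are
endoscopic at every non-split place), sign compatibility gives `cA = cB` — the parity constraint is then a
CONSISTENCY condition on the constants, not a condition on `σ` -/
theorem cA_eq_cB_of_forall_two (T : TwoTorusData D) (R : TransportData D T) (N : SignData D T R)
    (σ : T.Cons) (h2 : ∀ v ∈ N.S, N.two σ v = true) (h : R.swapOK σ) : N.cA = N.cB :=
  (parity_of_swapOK D T R N σ h).mp (even_filter_of_forall_two D T R N σ h2)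

/-- (sanity, PROVED) the interface is inhabited over EVERY transport: `Place := Fin 2`, `S := univ` (even), both
places two-member, `epsA ≡ 1`, `epsB ≡ −1` exactly on the sign-compatible `σ`, constants `1`. So `SignData` carries
no axiom by itself (exactly as `tautTwoTorusData` for `TwoTorusData`); its teeth are the identification of its
fields with the printed Tunnell–Saito signs in INPUTS.md. -/
def tautSignData (T : TwoTorusData D) (R : TransportData D T) [DecidablePred R.swapOK] : SignData D T R where
  Place := Fin 2
  S := Finset.univ
  S_even := by simp
  two := fun _ _ => true
  epsA := fun _ _ => 1
  epsB := fun σ _ => if R.swapOK σ then -1 else 1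
  supp := fun _ => Finset.univ
  S_subset := fun _ => Finset.Subset.refl _
  eps_eq_of_not_two := fun _ _ h => by simp at h
  local_rule := fun σ => by
    constructor
    · intro h v _
      simp [h]
    · intro h
      by_contra hs
      have := h 0 rfl
      simp [hs] at this
  cA := 1
  cB := 1
  prod_A := fun _ => by simp
  prod_B := fun σ => by
    split_ifs with h
    · simp
    · simp

/-- (PROVED) `SignData D T R` is non-empty for every transport -/
theorem signData_nonempty (T : TwoTorusData D) (R : TransportData D T) : Nonempty (SignData D T R) := by
  classical
  exact ⟨tautSignData D T R⟩

end

end Summit.Ventures.HodgeRepro2.Tier7.Line1
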